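import Literature.NumberTheory.EllipticCurves.DescendedFrobeniusMatrix
import Literature.NumberTheory.EllipticCurves.FormalGroupNegOmegaProofs
import Summits.BirchSwinnertonDyer.BirchSwinnertonDyer.Theorems.ClassRecordThreeRung62310y1HeightEvalFormalLog
import HarnessLib

/-!
# Route `CyclotomicUntwist`: the second-kind differential `η = x·ω` has RESIDUE ZERO at `O` — the expansion
# `z²x(z)·ω(z)/dz = 1 + 0·z + ⋯`, certifying the regular representative `∫(xω − dz/z²)` (`formalEtaIntegral`) of the
# class `[η]` used by `Literature.DescendedFrobeniusMatrix`

Cell `pub/bsd-wall` (D-0145 line `route-BirchSwinnertonDyer-CyclotomicUntwist`), prover seat `bsd-line-cycu-p2`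
(gen 6), lane «D5». THEOREMS ONLY (no definition, no named fact, no `sorry`); helper `--supports` K1 =
stmt-BirchSwinnertonDyer-21580 (serves K2 = 21581 and C2 = 27549). BSD is not proved by this file and no crux is.

The Literature definition `WeierstrassCurve.formalEtaIntegral` (p623342) represents the de Rham class of `η = x·ω` in
Katz's module by `∫ (x·ω − dz/z²) = Σ_{n ≥ 1} (P_{n+1}/n) zⁿ`, `P := formalXMulSq · formalOmega = z²x(z)·(ω/dz)`,
DROPPING the coefficients `P₀` and `P₁` — honest exactly when `P₀ = 1` (the double poles of `xω` and `dz/z² = d(y/x)`,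
`y/x = −1/z`, cancel) and `P₁ = 0` (NO RESIDUE: `η` is of the second kind), as asserted in its docstring. This file
PROVES both: `constantCoeff_formalXMulSq_mul_formalOmega` (`P₀ = 1`) and `coeff_one_formalXMulSq_mul_formalOmega`
(`P₁ = 0`), from the tree's `coeff_one_formalXMulSq = −a₁` (`FormalGroupNegOmegaProofs`) and `coeff_one_formalOmega = a₁`
(`Rank1Residual.X11b.RegMult.Rung62310y1`, reused by name). Over any `ℚ`-algebra; in particular for the good models over
`ℚ₃(ζ₉)`.
[cite: SilvermanAEC2009, IV.1 (expansions of x, y, ω)] [cite: Katz1981CrystallineDieudonne, §5 Lemma 5.1.2]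
-/

set_option autoImplicit false
-- single-conjunct summit: `Summit.BirchSwinnertonDyer.BirchSwinnertonDyer.…` repeats the name by design
set_option linter.dupNamespace false

noncomputable section

open PowerSeries

namespace Summit.BirchSwinnertonDyer.BirchSwinnertonDyer.Theorems.FormalEtaResidue

section RatAlgebra

variable {A : Type*} [CommRing A] [Algebra ℚ A] (W : WeierstrassCurve A)

/-- **`P₀ = 1`**: the double poles of `x·ω` and `dz/z²` cancel (`z²x(z) = 1 + ⋯`, `ω/dz = 1 + ⋯`).
[cite: SilvermanAEC2009, IV.1] -/
theorem constantCoeff_formalXMulSq_mul_formalOmega : constantCoeff (W.formalXMulSq * W.formalOmega) = 1 := by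
  rw [map_mul, W.constantCoeff_formalXMulSq, W.constantCoeff_formalOmega, one_mul]

/-- **`P₁ = 0`: the residue of `η = x·ω` at `O` vanishes** (`[z](z²x) = −a₁`, `[z](ω/dz) = a₁`) — `η` is of the
SECOND KIND, so `xω − dz/z² = Σ_{n≥0} P_{n+2}zⁿ dz` is regular at `O` and `formalEtaIntegral` is its honest integral.
[cite: SilvermanAEC2009, IV.1] [cite: Katz1981CrystallineDieudonne, §5 Lemma 5.1.2] -/
theorem coeff_one_formalXMulSq_mul_formalOmega : coeff 1 (W.formalXMulSq * W.formalOmega) = 0 := by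
  rw [PowerSeries.coeff_one_mul, W.coeff_one_formalXMulSq, W.constantCoeff_formalOmega,
    Summit.BirchSwinnertonDyer.Rank1Residual.X11b.RegMult.Rung62310y1.coeff_one_formalOmega,
    W.constantCoeff_formalXMulSq]
  ring

/-- The linear coefficient of the representative: `[z] ∫(xω − dz/z²) = P₂ = [z²](z²x·ω/dz)` (the formal integral
starts at the `z²`-coefficient of `P`, consistent with `P₀ = 1`, `P₁ = 0` being dropped).
[cite: Katz1981CrystallineDieudonne, §5 Lemma 5.1.2] -/
theorem coeff_one_formalEtaIntegral :
    coeff 1 W.formalEtaIntegral = coeff 2 (W.formalXMulSq * W.formalOmega) := by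
  rw [show (1 : ℕ) = 0 + 1 from rfl, W.coeff_succ_formalEtaIntegral 0]
  norm_num

end RatAlgebra

end Summit.BirchSwinnertonDyer.BirchSwinnertonDyer.Theorems.FormalEtaResidue
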